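import Mathlib.Analysis.Calculus.Deriv.Polynomial
import Literature.Analysis.FluidPDE.ElgindiCutoffCalculus
import HarnessLib

/-!
# Radial coefficient functions: polynomials in `u = z/(1+z)` and their scaling derivatives
([Elgindi2021] §6.3 / [ElgindiGhoulMasmoudi2021] §3.1: the radial factors of the commutator and
non-local terms)

Topic `Literature/Analysis/FluidPDE`. Support file (two definitions with bodies, everything proved;
no named facts) on the proof path of the named fact
`Literature.Analysis.FluidPDE.Elgindi.ElgindiGhoulMasmoudi2021_stabilityCore`
(`ElgindiStabilityDecomposition.lean`). In the `𝓗ᵏ` coercivity inductions of T. M. Elgindi,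
Ann. of Math. 194 (2021) = arXiv:1904.04795, §6.3 and of Elgindi–Ghoul–Masmoudi, arXiv:1910.14071,
§3.1 ("The first part of the second term comes when one `D_y` hits the factor `3/(1+y)` and the second
part of the second term comes when more than one derivative hits that factor"), the radial
derivative `D_z = z∂_z` falls on the rational coefficients `2/(1+z)`, `3/(1+z)`, `2z/(c(1+z)²)`,
`2z²/(c(1+z)³)` of `𝓛_Γ^T`. All of these are polynomials in `u = z/(1+z) ∈ [0, 1)`, and
`D_z` acts on such polynomials as the derivation `δ = u(1−u)d/du` (`D_zu = z/(1+z)² = u(1−u)`),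
which preserves every ideal `(u^a(1−u)^b)`. Consequently every `D_z`-derivative of a coefficient
vanishing like `z^a` at `0` and decaying like `z^{−b}` at infinity keeps these rates:
`|D_z^m(P(u))| ≤ C_m z^a/(1+z)^{a+b}` on `z ≥ 0` whenever `u^a(1−u)^b ∣ P`. This file proves exactly
this (`uPolyFun`, `uDeriv`, `iterate_Dz₁_uPolyFun`, `exists_abs_iterate_Dz₁_uPolyFun_le`), with the
smoothness of these coefficients away from `z = −1`.
-/

noncomputable section

open Set Function Real Filter Polynomial
open _root_.Topology

namespace Literature.Analysis.FluidPDE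

namespace Elgindi

/-! ### Polynomials in `u = z/(1+z)` -/

/-- The radial function `z ↦ P(z/(1+z))` attached to a real polynomial `P` (junk at `z = −1`). [folklore] -/
def uPolyFun (P : ℝ[X]) (z : ℝ) : ℝ :=
  P.eval (z / (1 + z))

/-- The derivation `δP = u(1−u)P'`: the action of `D_z = z∂_z` on polynomials in `u = z/(1+z)`. [folklore] -/
def uDeriv (P : ℝ[X]) : ℝ[X] :=
  X * (1 - X) * derivative P

/-- Unfolding `uPolyFun`. [folklore] -/
theorem uPolyFun_apply (P : ℝ[X]) (z : ℝ) : uPolyFun P z = P.eval (z / (1 + z)) := rfl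

/-- The variable `u = z/(1+z)` has derivative `1/(1+z)²` away from `z = −1`. [folklore] -/
theorem hasDerivAt_u {z : ℝ} (hz : 1 + z ≠ 0) : HasDerivAt (fun z : ℝ => z / (1 + z)) (1 / (1 + z) ^ 2) z := by
  have hden : HasDerivAt (fun z : ℝ => 1 + z) 1 z := by simpa using (hasDerivAt_id' z).const_add 1
  have h := (hasDerivAt_id' z).div hden hz
  refine h.congr_deriv ?_
  field_simp
  ring

/-- `D_z(P(u)) = (δP)(u)` away from `z = −1`. [folklore] -/
theorem Dz₁_uPolyFun (P : ℝ[X]) {z : ℝ} (hz : 1 + z ≠ 0) : Dz₁ (uPolyFun P) z = uPolyFun (uDeriv P) z := by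
  have h := (P.hasDerivAt (z / (1 + z))).comp z (hasDerivAt_u hz)
  have e : uPolyFun P = (fun x => P.eval x) ∘ fun z => z / (1 + z) := rfl
  rw [Dz₁_apply, e, h.deriv, uPolyFun_apply, uDeriv]
  simp only [eval_mul, eval_X, eval_sub, eval_one]
  field_simp
  ring

/-- `Dz₁` is local: functions agreeing on an open set have the same iterated `Dz₁` there. [folklore] -/
theorem iterate_Dz₁_congr_of_eqOn {c d : ℝ → ℝ} {U : Set ℝ} (hU : IsOpen U) (h : EqOn c d U) (m : ℕ) :
    EqOn (Dz₁^[m] c) (Dz₁^[m] d) U := by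
  induction m generalizing c d with
  | zero => simpa using h
  | succ m ih =>
    intro z hz
    rw [Function.iterate_succ_apply, Function.iterate_succ_apply]
    refine ih (fun y hy => ?_) hz
    have hev : c =ᶠ[𝓝 y] d := Filter.eventuallyEq_of_mem (hU.mem_nhds hy) h
    rw [Dz₁_apply, Dz₁_apply, hev.deriv_eq]

/-- **`D_z^m(P(u)) = (δ^mP)(u)`** away from `z = −1`. [folklore] -/
theorem iterate_Dz₁_uPolyFun (P : ℝ[X]) (m : ℕ) {z : ℝ} (hz : 1 + z ≠ 0) :
    Dz₁^[m] (uPolyFun P) z = uPolyFun (uDeriv^[m] P) z := by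
  have hU : IsOpen {z : ℝ | 1 + z ≠ 0} := isOpen_ne_fun (by fun_prop) continuous_const
  induction m generalizing P with
  | zero => rfl
  | succ m ih =>
    rw [Function.iterate_succ_apply, Function.iterate_succ_apply]
    have heq : EqOn (Dz₁ (uPolyFun P)) (uPolyFun (uDeriv P)) {z : ℝ | 1 + z ≠ 0} :=
      fun y hy => Dz₁_uPolyFun P hy
    rw [iterate_Dz₁_congr_of_eqOn hU heq m hz]
    exact ih (uDeriv P)

/-- Polynomial functions are smooth. [folklore] -/
theorem contDiff_eval_polynomial (P : ℝ[X]) (n : WithTop ℕ∞) : ContDiff ℝ n fun x : ℝ => P.eval x := by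
  induction P using Polynomial.induction_on' with
  | add p q hp hq => simpa only [eval_add] using hp.add hq
  | monomial k a =>
    simp only [eval_monomial]
    exact contDiff_const.mul (contDiff_id.pow k)

/-- `P(u)` is smooth away from `z = −1`. [folklore] -/
theorem contDiffOn_uPolyFun (P : ℝ[X]) (n : WithTop ℕ∞) : ContDiffOn ℝ n (uPolyFun P) {z : ℝ | 1 + z ≠ 0} := by
  have hu : ContDiffOn ℝ n (fun z : ℝ => z / (1 + z)) {z : ℝ | 1 + z ≠ 0} :=
    contDiffOn_id.div (by fun_prop) fun z hz => hz
  exact ((contDiff_eval_polynomial P n).comp_contDiffOn hu).congr fun z _ => rfl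

/-- `P(u)` is smooth on `z > 0`. [folklore] -/
theorem contDiffOn_uPolyFun_Ioi (P : ℝ[X]) (n : WithTop ℕ∞) : ContDiffOn ℝ n (uPolyFun P) (Ioi 0) :=
  (contDiffOn_uPolyFun P n).mono fun z hz => by
    have : (0 : ℝ) < z := hz
    exact (by positivity : (1 : ℝ) + z ≠ 0)

/-! ### `δ` preserves the ideals `(u^a(1−u)^b)` -/

/-- `X·(X^a)' = a·X^a`. [folklore] -/
theorem X_mul_derivative_X_pow (a : ℕ) : (X : ℝ[X]) * derivative (X ^ a) = C (a : ℝ) * X ^ a := by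
  cases a with
  | zero => simp
  | succ a =>
    rw [derivative_X_pow]
    simp only [Nat.cast_succ, Nat.add_sub_cancel]
    ring

/-- `(1−X)·((1−X)^b)' = −b·(1−X)^b`. [folklore] -/
theorem one_sub_X_mul_derivative_pow (b : ℕ) :
    (1 - X : ℝ[X]) * derivative ((1 - X) ^ b) = -(C (b : ℝ) * (1 - X) ^ b) := by
  cases b with
  | zero => simp
  | succ b =>
    rw [derivative_pow]
    simp only [Nat.cast_succ, Nat.add_sub_cancel, derivative_sub, derivative_one, derivative_X]
    ring

/-- **Leibniz for `δ` on the ideal generators**: `δ(u^a(1−u)^bQ) = u^a(1−u)^b·(a(1−u)Q − buQ + u(1−u)Q')`. [folklore] -/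
theorem uDeriv_mul_gen (a b : ℕ) (Q : ℝ[X]) :
    uDeriv (X ^ a * (1 - X) ^ b * Q) =
      X ^ a * (1 - X) ^ b * (C (a : ℝ) * (1 - X) * Q - C (b : ℝ) * X * Q + X * (1 - X) * derivative Q) := by
  unfold uDeriv
  rw [derivative_mul, derivative_mul]
  have h1 := X_mul_derivative_X_pow a
  have h2 := one_sub_X_mul_derivative_pow b
  -- `X(1−X)[(X^a)'(1−X)^b Q + X^a((1−X)^b)' Q + X^a(1−X)^b Q']`
  calc (X : ℝ[X]) * (1 - X) * ((derivative (X ^ a) * (1 - X) ^ b + X ^ a * derivative ((1 - X) ^ b)) * Q +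
        X ^ a * (1 - X) ^ b * derivative Q)
      = (X * derivative (X ^ a)) * ((1 - X) * (1 - X) ^ b * Q) +
          ((1 - X) * derivative ((1 - X) ^ b)) * (X * X ^ a * Q) +
          X * (1 - X) * (X ^ a * (1 - X) ^ b * derivative Q) := by ring
    _ = (C (a : ℝ) * X ^ a) * ((1 - X) * (1 - X) ^ b * Q) +
          (-(C (b : ℝ) * (1 - X) ^ b)) * (X * X ^ a * Q) +
          X * (1 - X) * (X ^ a * (1 - X) ^ b * derivative Q) := by rw [h1, h2]
    _ = _ := by ring

/-- **`δ` preserves divisibility by `u^a(1−u)^b`.** [folklore] -/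
theorem gen_dvd_uDeriv {a b : ℕ} {P : ℝ[X]} (h : X ^ a * (1 - X) ^ b ∣ P) : X ^ a * (1 - X) ^ b ∣ uDeriv P := by
  obtain ⟨Q, rfl⟩ := h
  rw [uDeriv_mul_gen]
  exact dvd_mul_right _ _

/-- Iterated. [folklore] -/
theorem gen_dvd_iterate_uDeriv {a b : ℕ} {P : ℝ[X]} (h : X ^ a * (1 - X) ^ b ∣ P) (m : ℕ) :
    X ^ a * (1 - X) ^ b ∣ uDeriv^[m] P := by
  induction m with
  | zero => simpa using h
  | succ m ih => rw [Function.iterate_succ_apply']; exact gen_dvd_uDeriv ih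

/-! ### Bounds on `z ≥ 0` -/

/-- A polynomial is bounded on `[0, 1]` by the sum of the absolute values of its coefficients. [folklore] -/
theorem abs_eval_le_of_mem_Icc (Q : ℝ[X]) {x : ℝ} (hx : x ∈ Icc (0 : ℝ) 1) :
    |Q.eval x| ≤ ∑ i ∈ Finset.range (Q.natDegree + 1), |Q.coeff i| := by
  rw [eval_eq_sum_range]
  refine (Finset.abs_sum_le_sum_abs _ _).trans (Finset.sum_le_sum fun i _ => ?_)
  rw [abs_mul, abs_pow, abs_of_nonneg hx.1]
  calc |Q.coeff i| * x ^ i ≤ |Q.coeff i| * 1 :=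
        mul_le_mul_of_nonneg_left (pow_le_one₀ hx.1 hx.2) (abs_nonneg _)
    _ = |Q.coeff i| := mul_one _

/-- **The decay of a coefficient in the ideal `(u^a(1−u)^b)`**: if `u^a(1−u)^b ∣ P` then
`|P(u(z))| ≤ C·z^a/(1+z)^{a+b}` for `z ≥ 0`. [folklore] -/
theorem exists_abs_uPolyFun_le {a b : ℕ} {P : ℝ[X]} (h : X ^ a * (1 - X) ^ b ∣ P) :
    ∃ C, 0 ≤ C ∧ ∀ z : ℝ, 0 ≤ z → |uPolyFun P z| ≤ C * (z ^ a / (1 + z) ^ (a + b)) := by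
  obtain ⟨Q, rfl⟩ := h
  refine ⟨∑ i ∈ Finset.range (Q.natDegree + 1), |Q.coeff i|, Finset.sum_nonneg fun i _ => abs_nonneg _,
    fun z hz => ?_⟩
  have hz1 : (0 : ℝ) < 1 + z := by positivity
  set x : ℝ := z / (1 + z) with hx
  have hx0 : 0 ≤ x := by positivity
  have hx1 : x ≤ 1 := by rw [hx, div_le_one hz1]; linarith
  have h1x : 1 - x = 1 / (1 + z) := by rw [hx]; field_simp; ring
  rw [uPolyFun_apply, ← hx]
  simp only [eval_mul, eval_pow, eval_X, eval_sub, eval_one]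
  rw [abs_mul, abs_mul, abs_pow, abs_pow, abs_of_nonneg hx0, abs_of_nonneg (by linarith : (0 : ℝ) ≤ 1 - x)]
  have hgen : x ^ a * (1 - x) ^ b = z ^ a / (1 + z) ^ (a + b) := by
    rw [h1x, hx, div_pow, div_pow, one_pow, pow_add]
    field_simp
  calc x ^ a * (1 - x) ^ b * |Q.eval x| ≤ x ^ a * (1 - x) ^ b * ∑ i ∈ Finset.range (Q.natDegree + 1), |Q.coeff i| :=
        mul_le_mul_of_nonneg_left (abs_eval_le_of_mem_Icc Q ⟨hx0, hx1⟩) (by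
          have : 0 ≤ 1 - x := by linarith
          positivity)
    _ = (∑ i ∈ Finset.range (Q.natDegree + 1), |Q.coeff i|) * (z ^ a / (1 + z) ^ (a + b)) := by
        rw [hgen]; ring

/-- **All scaling derivatives keep the rates**: if `u^a(1−u)^b ∣ P` then for every `m`,
`|D_z^m(P(u))(z)| ≤ C_m·z^a/(1+z)^{a+b}` for `z ≥ 0`. [cite: ElgindiGhoulMasmoudi2021, §3.1 proof of Proposition 3.2 ("when one `D_y` hits the factor `3/(1+y)` … when more than one derivative hits that factor") (p. 10 of arXiv:1910.14071)] -/
theorem exists_abs_iterate_Dz₁_uPolyFun_le {a b : ℕ} {P : ℝ[X]} (h : X ^ a * (1 - X) ^ b ∣ P) (m : ℕ) :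
    ∃ C, 0 ≤ C ∧ ∀ z : ℝ, 0 ≤ z → |Dz₁^[m] (uPolyFun P) z| ≤ C * (z ^ a / (1 + z) ^ (a + b)) := by
  obtain ⟨C, hC0, hC⟩ := exists_abs_uPolyFun_le (gen_dvd_iterate_uDeriv h m)
  refine ⟨C, hC0, fun z hz => ?_⟩
  rw [iterate_Dz₁_uPolyFun P m (by positivity : (1 : ℝ) + z ≠ 0)]
  exact hC z hz

/-! ### The coefficients of `𝓛_Γ^T` -/

/-- `1/(1+z) = (1 − u)(u(z))`: the transport/linear coefficients `2/(1+z)`, `3/(1+z)`. [folklore] -/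
theorem one_div_one_add_eq_uPolyFun {z : ℝ} (hz : 1 + z ≠ 0) : 1 / (1 + z) = uPolyFun (1 - X) z := by
  rw [uPolyFun_apply]
  simp only [eval_sub, eval_one, eval_X]
  field_simp
  ring

/-- `z/(1+z)² = (u(1 − u))(u(z))`: the coefficient of the `L₁₂` term. [folklore] -/
theorem div_one_add_sq_eq_uPolyFun {z : ℝ} (hz : 1 + z ≠ 0) : z / (1 + z) ^ 2 = uPolyFun (X * (1 - X)) z := by
  rw [uPolyFun_apply]
  simp only [eval_mul, eval_sub, eval_one, eval_X]
  field_simp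
  ring

/-- `z²/(1+z)³ = (u²(1 − u))(u(z))`: the coefficient of the projector profile. [folklore] -/
theorem sq_div_one_add_cube_eq_uPolyFun {z : ℝ} (hz : 1 + z ≠ 0) :
    z ^ 2 / (1 + z) ^ 3 = uPolyFun (X ^ 2 * (1 - X)) z := by
  rw [uPolyFun_apply]
  simp only [eval_mul, eval_pow, eval_sub, eval_one, eval_X]
  field_simp
  ring

/-- **The `D_z`-derivatives of `1/(1+z)` stay bounded by `C/(1+z)`** on `z ≥ 0`. [folklore] -/
theorem exists_abs_iterate_Dz₁_one_div_one_add_le (m : ℕ) :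
    ∃ C, 0 ≤ C ∧ ∀ z : ℝ, 0 ≤ z → |Dz₁^[m] (fun z : ℝ => 1 / (1 + z)) z| ≤ C * (1 / (1 + z)) := by
  have hdvd : (X : ℝ[X]) ^ 0 * (1 - X) ^ 1 ∣ (1 - X) := by simp
  obtain ⟨C, hC0, hC⟩ := exists_abs_iterate_Dz₁_uPolyFun_le hdvd m
  refine ⟨C, hC0, fun z hz => ?_⟩
  have hU : IsOpen (Ioi (-1 : ℝ)) := isOpen_Ioi
  have heq : EqOn (fun z : ℝ => 1 / (1 + z)) (uPolyFun (1 - X)) (Ioi (-1 : ℝ)) := fun y hy =>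
    one_div_one_add_eq_uPolyFun (by have : (-1 : ℝ) < y := hy; linarith)
  rw [iterate_Dz₁_congr_of_eqOn hU heq m (by show (-1 : ℝ) < z; linarith)]
  simpa using hC z hz

/-- **The `D_z`-derivatives of `z/(1+z)²` stay bounded by `C·z/(1+z)²`** on `z ≥ 0`. [folklore] -/
theorem exists_abs_iterate_Dz₁_div_one_add_sq_le (m : ℕ) :
    ∃ C, 0 ≤ C ∧ ∀ z : ℝ, 0 ≤ z → |Dz₁^[m] (fun z : ℝ => z / (1 + z) ^ 2) z| ≤ C * (z / (1 + z) ^ 2) := by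
  have hdvd : (X : ℝ[X]) ^ 1 * (1 - X) ^ 1 ∣ X * (1 - X) := by simp
  obtain ⟨C, hC0, hC⟩ := exists_abs_iterate_Dz₁_uPolyFun_le hdvd m
  refine ⟨C, hC0, fun z hz => ?_⟩
  have hU : IsOpen (Ioi (-1 : ℝ)) := isOpen_Ioi
  have heq : EqOn (fun z : ℝ => z / (1 + z) ^ 2) (uPolyFun (X * (1 - X))) (Ioi (-1 : ℝ)) := fun y hy =>
    div_one_add_sq_eq_uPolyFun (by have : (-1 : ℝ) < y := hy; linarith)
  rw [iterate_Dz₁_congr_of_eqOn hU heq m (by show (-1 : ℝ) < z; linarith)]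
  simpa using hC z hz

/-- **The `D_z`-derivatives of `z²/(1+z)³` stay bounded by `C·z²/(1+z)³`** on `z ≥ 0`. [folklore] -/
theorem exists_abs_iterate_Dz₁_sq_div_one_add_cube_le (m : ℕ) :
    ∃ C, 0 ≤ C ∧ ∀ z : ℝ, 0 ≤ z → |Dz₁^[m] (fun z : ℝ => z ^ 2 / (1 + z) ^ 3) z| ≤ C * (z ^ 2 / (1 + z) ^ 3) := by
  have hdvd : (X : ℝ[X]) ^ 2 * (1 - X) ^ 1 ∣ X ^ 2 * (1 - X) := by simp
  obtain ⟨C, hC0, hC⟩ := exists_abs_iterate_Dz₁_uPolyFun_le hdvd m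
  refine ⟨C, hC0, fun z hz => ?_⟩
  have hU : IsOpen (Ioi (-1 : ℝ)) := isOpen_Ioi
  have heq : EqOn (fun z : ℝ => z ^ 2 / (1 + z) ^ 3) (uPolyFun (X ^ 2 * (1 - X))) (Ioi (-1 : ℝ)) := fun y hy =>
    sq_div_one_add_cube_eq_uPolyFun (by have : (-1 : ℝ) < y := hy; linarith)
  rw [iterate_Dz₁_congr_of_eqOn hU heq m (by show (-1 : ℝ) < z; linarith)]
  simpa using hC z hz

/-- Smoothness of the three coefficients on `z > −1` (hence on `z > 0`). [folklore] -/
theorem contDiffOn_coeffs (n : WithTop ℕ∞) :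
    ContDiffOn ℝ n (fun z : ℝ => 1 / (1 + z)) (Ioi (-1)) ∧
    ContDiffOn ℝ n (fun z : ℝ => z / (1 + z) ^ 2) (Ioi (-1)) ∧
    ContDiffOn ℝ n (fun z : ℝ => z ^ 2 / (1 + z) ^ 3) (Ioi (-1)) := by
  have hne : ∀ z ∈ Ioi (-1 : ℝ), (1 : ℝ) + z ≠ 0 := fun z hz => by
    have : (-1 : ℝ) < z := hz; linarith
  refine ⟨?_, ?_, ?_⟩
  · exact contDiffOn_const.div (by fun_prop) hne
  · exact contDiffOn_id.div (by fun_prop) fun z hz => pow_ne_zero 2 (hne z hz)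
  · exact (contDiffOn_id.pow 2).div (by fun_prop) fun z hz => pow_ne_zero 3 (hne z hz)

end Elgindi

end Literature.Analysis.FluidPDE
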